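import Summits.BirchSwinnertonDyer.BirchSwinnertonDyer.Theorems.KatoDescentPotSupersingularCartanMuRoadRealDoors
import Summits.BirchSwinnertonDyer.BirchSwinnertonDyer.Theorems.KatoDescentTamePotSupersingularTameUpperOptimalSharpNodesJ08S2MDLower
import HarnessLib

/-!
# KT `TameCoatesSujathaResidue` (stmt-19916; U₀-ns node 19202 → parent 19982) — the `p = 3` Cartan μ-road DOORS for the (t′)
# residue rows: statement (A) at `(W, 3)` and the U₀ statement `MissingUpperBoundAt W 3` on a rank-`0` (t′) row with `W[3]`
# irreducible and Cartan-normaliser image, from ONE classical `μ = 0` hypothesis on the maximal real subfield of `ℚ(W[3])`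
# (cell `bsd-potss`, seat `bsd-potss-k8t-c4` g16; KT twin of k9-c4 g18's `CartanMuRoadRealDoors` §3; route-free;
# `--supports stmt-BirchSwinnertonDyer-19982 --as helper`; closes nothing)

HONEST FRAMING. Route-free THEOREMS ONLY (no definition, no named fact, no `sorry`). k9-c4 g18's `CartanMuRoadRealDoors`
(p626162) gives statement (A) at `(W, 3)` for ANY elliptic `W/ℚ` from the mod-`3` image predicate
(`HasSplitCartanNormalizerModPImage W 3` / `HasModPImageEqNonsplitCartanNormalizer W 3`), a complex conjugation `c ∈ Γ_ℚ` and
`μ = 0` for every cyclotomic `ℤ_3`-extension of the fixed field of `c|_{ℚ(W[3])}` (the maximal real subfield `ℚ(W[3])⁺ = ℚ(P)`,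
`P` a real `3`-torsion point), modulo the NAMED FACTS Coates–Sujatha 2005 Thm. 3.4 (`hCS`), Ferrero–Washington (`hFW`) [and
Iwasawa's growth theorem `hI` on `3Nn` rows] — conjA-anchor g11's road N3/N4 (p620354/p620850) with the involution binders discharged
by `c`. Its §3 composes with the K9 (WILD, `ClassO6`) upper-half reading. THIS FILE is the (t′) composition: §1 re-homes privately the
fine-Selmer port of Kato 14.5 (3) on an irreducible rank-`0` (t′) row (`missingUpperBoundAt_tame_of_irreducible_of_fineSelmerDual_fg`,
public original in the route-importing `…TameUpperNonsurjTowerFineSelmer`, p-private copies in the node files); §2 are the three KT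
doors `MissingUpperBoundAt W 3 ⟸ {hKatoA, hGZK, hmod, hCS, hFW [, hI]} + r_an = 0 + Addv W 3 + SubTprime W 3 + W[3] irreducible +
image predicate + c + hμ [+ hμ′]`. On the KT census these doors serve exactly the two `p = 3` Conj-A residue rows of 19916
(130095bp1, 470304m1: multi-Tamagawa, `3Nn`); the third residue row 283200gf1 is at `p = 5` (`5Ns`) and has no door here.
Nothing is asserted about any curve; (A), Conjecture A and BSD are proved for no curve here.
[cite: CoatesSujatha2005, Thm. 3.4 (§3)] [cite: Kato2004Asterisque, Thm. 14.5 (3) (p. 236), Thm. 12.5 (3) (p. 222), 14.14 (p. 243)]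
[cite: Serre1972, §2.2, §5.2 (iii)–(iv)] [cite: Washington1997, §7.5, §13.1] [cite: Miller2011LMS, Def. 1.1]
-/

set_option linter.dupNamespace false
set_option autoImplicit false

noncomputable section

open scoped Classical NumberField
open Field IntermediateField WeierstrassCurve Literature.NumberTheory.EllipticCurves
  Literature.NumberTheory.EllipticCurves.Rank1Residual
  Literature.NumberTheory.EllipticCurves.Rank1Residual.Typed
  Literature.NumberTheory.GaloisRepresentations Literature.NumberTheory.SerreUniformity
  Literature.NumberTheory.IwasawaTheory
  Summit.BirchSwinnertonDyer.Rank1Residual Summit.BirchSwinnertonDyer.Rank1Residual.Additive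

namespace Summit.BirchSwinnertonDyer.BirchSwinnertonDyer.Theorems.CartanMuRoadRealDoorsTprime

/-! ### §1 The fine-Selmer port of Kato 14.5 (3) on an irreducible rank-`0` (t′) row (private re-homing) -/

/-- **The fine-Selmer port of Kato 14.5 (3) on an irreducible rank-`0` (t′) row** (private verbatim re-homing of
`Theorems.missingUpperBoundAt_tame_of_irreducible_of_fineSelmerDual_fg`, whose module imports the route): at an odd additive
potentially good `p` with `E[p]` irreducible and `Y(E/ℚ^cyc)` finitely generated over `ℤ_p` (`hA`), the upper half
(`ord_p #Ш + v_p ∏c_ℓ ≤ ord_p (L/Ω)`, `#Ш_an = (L/Ω)·#tors²/∏c_ℓ`, torsion term killed by irreducibility).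
[cite: Kato2004Asterisque, Thm. 14.5 (3) (p. 236), Thm. 12.5 (3) (p. 222), 14.14 (p. 243)] [cite: Lim2017FineSelmer, §3]
[cite: Miller2011LMS, Def. 1.1] -/
private theorem missingUpperBoundAt_tame_of_irreducible_of_fineSelmerDual_fg
    (hKatoA :
      Kato2004.rankZero_padicValNat_sha_add_padicValNat_tamagawa_le_of_additive_potGood_of_irreducible_of_fineSelmerDual_fg)
    (hGZK : rank_eq_analyticRank_of_analyticRank_le_one) (hmod : hasEntireLFunction_rat)
    (W : WeierstrassCurve ℚ) [W.IsElliptic] [W.IsGloballyMinimal] (p : ℕ) [Fact p.Prime]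
    (hr : W.analyticRank = 0) (hp2 : p ≠ 2) (hadd : Addv W p) (hT : SubTprime W p)
    (hirr : W.HasIrreducibleModPGaloisRep p)
    (hA : ∀ (κ : ZpExtension ℚ p), κ.IsCyclotomic →
      ∃ (γ : Field.absoluteGaloisGroup ℚ) (D : W.FineSelmerDualData κ γ),
        Module.Finite ℤ_[p] (RestrictScalars ℤ_[p] (IwasawaAlgebra p) D.X)) :
    MissingUpperBoundAt W p := by
  have hO5 : ClassO5 W p := ⟨hp2, hadd, Or.inr hT⟩
  have hL : W.entireLFunction 1 ≠ 0 := (W.analyticRank_eq_zero_iff_holds (hmod W)).mp hr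
  obtain ⟨hmw, hfin⟩ := hGZK W (by rw [hr]; exact zero_le_one)
  haveI : Finite W.sha := hfin
  have hmw0 : W.mordellWeilRank = 0 := by rw [hmw, hr]
  obtain ⟨q₀, hq₀, hle⟩ := hKatoA W p hp2 hadd.1 hadd.2 hO5.padicValRat_j_nonneg hirr hA hL hfin
  have hΩpos : 0 < W.realPeriodRat := W.realPeriodRat_pos_holds
  have hΩ : (W.realPeriodRat : ℂ) ≠ 0 := by exact_mod_cast hΩpos.ne'
  have hc0 : 0 < W.tamagawaProduct := W.tamagawaProduct_pos_holds
  have ht0 : 0 < W.torsionOrder := W.torsionOrder_pos_holds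
  have hq₀0 : q₀ ≠ 0 := by
    rintro rfl
    rw [Rat.cast_zero, div_eq_zero_iff] at hq₀
    exact hq₀.elim hL hΩ
  refine ⟨q₀ * (W.torsionOrder : ℚ) ^ 2 / (W.tamagawaProduct : ℚ), ?_, ?_⟩
  · have hLq : W.entireLFunction 1 = (q₀ : ℂ) * (W.realPeriodRat : ℂ) := by
      rw [← hq₀, div_mul_cancel₀ _ hΩ]
    rw [shaAn_def, W.leadingLCoeff_eq_of_analyticRank_eq_zero hr,
      W.regulator_eq_one_of_rank_zero hmw0, hLq]
    push_cast
    field_simp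
  · have ht : (W.torsionOrder : ℚ) ≠ 0 := by exact_mod_cast ht0.ne'
    have hcq : (W.tamagawaProduct : ℚ) ≠ 0 := by exact_mod_cast hc0.ne'
    have hsha : padicValNat p (Nat.card (AddCommGroup.primaryComponent W.sha p)) =
        padicValNat p W.shaOrder := by
      unfold WeierstrassCurve.shaOrder
      exact padicValNat_card_addPrimaryComponent p
    have htors : (padicValNat p W.torsionOrder : ℤ) = 0 := by
      exact_mod_cast padicValNat_torsionOrder_eq_zero_of_irreducible W p hirr
    have hv : padicValRat p (q₀ * (W.torsionOrder : ℚ) ^ 2 / (W.tamagawaProduct : ℚ)) =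
        padicValRat p q₀ + 2 * (padicValNat p W.torsionOrder : ℤ) -
          (padicValNat p W.tamagawaProduct : ℤ) := by
      rw [padicValRat.div (mul_ne_zero hq₀0 (pow_ne_zero 2 ht)) hcq,
        padicValRat.mul hq₀0 (pow_ne_zero 2 ht), pow_two, padicValRat.mul ht ht,
        padicValRat.of_nat, padicValRat.of_nat]
      ring
    rw [hv, ← hsha, htors]
    linarith


/-! ### §2 The KT doors: U₀ `MissingUpperBoundAt W 3` at a (t′) Cartan residue row through (A) -/

section Upper

variable (W : WeierstrassCurve ℚ) [W.IsElliptic] [W.IsGloballyMinimal]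

/-- **U₀ at a `3Ns` (t′) residue row from ONE classical `μ`-hypothesis**: `ord₃ #Ш(W) ≤ ord₃ #Ш_an(W)` (`MissingUpperBoundAt W 3`)
for a rank-`0` (t′) row (`Addv W 3`, `SubTprime W 3`) with `W[3]` irreducible and `3Ns` image, from Kato's fine-Selmer reading
(`hKatoA`), GZK (`hGZK`), modularity (`hmod`), Coates–Sujatha Thm. 3.4 (`hCS`), Ferrero–Washington (`hFW`) — named facts — and
`μ = 0` for the cyclotomic `ℤ_3`-extension of the maximal real subfield of `ℚ(W[3])` (`hμ`). CONDITIONAL; nothing booked; BSD for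
no curve. [cite: Kato2004Asterisque, Thm. 14.5 (3) (p. 236), Thm. 12.5 (3) (p. 222)] [cite: CoatesSujatha2005, Thm. 3.4 (§3)]
[cite: Serre1972, §5.2 (iv)] -/
theorem missingUpperBoundAt_three_tame_of_hasSplitCartanNormalizerModPImage_of_realMu
    (hKatoA : Kato2004.rankZero_padicValNat_sha_add_padicValNat_tamagawa_le_of_additive_potGood_of_irreducible_of_fineSelmerDual_fg)
    (hGZK : rank_eq_analyticRank_of_analyticRank_le_one) (hmod : hasEntireLFunction_rat)
    (hCS : CoatesSujatha2005.thm34_fineSelmerDual_moduleFinite_of_classicalMuVanishes_divisionField)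
    (hFW : ferreroWashington1979_classicalMuVanishes) [Fact (3 : ℕ).Prime]
    (hr : W.analyticRank = 0) (hadd : Addv W 3) (hT : SubTprime W 3) (hirr : W.HasIrreducibleModPGaloisRep 3)
    (himg : HasSplitCartanNormalizerModPImage W 3) {c : absoluteGaloisGroup ℚ} (hc : IsComplexConjugation (Rat.castHom ℝ) c)
    (hμ : ∀ κE : ZpExtension ↥(fixedField (Subgroup.zpowers (absRestrictNormalHom (W.divisionField 3) c))) 3,
      κE.IsCyclotomic → ClassicalMuVanishes κE) :
    MissingUpperBoundAt W 3 :=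
  missingUpperBoundAt_tame_of_irreducible_of_fineSelmerDual_fg hKatoA hGZK hmod W 3 hr (by decide) hadd hT hirr
    (CartanMuRoadRealDoors.conjA_three_of_hasSplitCartanNormalizerModPImage_of_realMu W hCS hFW himg hc hμ)

/-- **U₀ at a `3Nn` (t′) residue row from ONE classical `μ`-hypothesis, paying Iwasawa's growth theorem** (`hI`): as above with
`HasModPImageEqNonsplitCartanNormalizer W 3` (the road for the KT residue rows 130095bp1 / 470304m1). CONDITIONAL; nothing
booked; BSD for no curve. [cite: Kato2004Asterisque, Thm. 14.5 (3) (p. 236)] [cite: CoatesSujatha2005, Thm. 3.4 (§3)]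
[cite: Washington1997, §13.1] -/
theorem missingUpperBoundAt_three_tame_of_hasModPImageEqNonsplitCartanNormalizer_of_realMu'
    (hKatoA : Kato2004.rankZero_padicValNat_sha_add_padicValNat_tamagawa_le_of_additive_potGood_of_irreducible_of_fineSelmerDual_fg)
    (hGZK : rank_eq_analyticRank_of_analyticRank_le_one) (hmod : hasEntireLFunction_rat)
    (hCS : CoatesSujatha2005.thm34_fineSelmerDual_moduleFinite_of_classicalMuVanishes_divisionField)
    (hI : iwasawa1959_classNumberPExp_growth) (hFW : ferreroWashington1979_classicalMuVanishes) [Fact (3 : ℕ).Prime]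
    (hr : W.analyticRank = 0) (hadd : Addv W 3) (hT : SubTprime W 3) (hirr : W.HasIrreducibleModPGaloisRep 3)
    (himg : HasModPImageEqNonsplitCartanNormalizer W 3) {c : absoluteGaloisGroup ℚ}
    (hc : IsComplexConjugation (Rat.castHom ℝ) c)
    (hμ : ∀ κE : ZpExtension ↥(fixedField (Subgroup.zpowers (absRestrictNormalHom (W.divisionField 3) c))) 3,
      κE.IsCyclotomic → ClassicalMuVanishes κE) :
    MissingUpperBoundAt W 3 :=
  missingUpperBoundAt_tame_of_irreducible_of_fineSelmerDual_fg hKatoA hGZK hmod W 3 hr (by decide) hadd hT hirr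
    (CartanMuRoadRealDoors.conjA_three_of_hasModPImageEqNonsplitCartanNormalizer_of_realMu' W hCS hI hFW himg hc hμ)

/-- **U₀ at a `3Nn` (t′) residue row, growth-fact-free, from TWO classical `μ`-hypotheses** (`ℚ(P)` and `ℚ(x(P))` of the real
`3`-torsion point `P`). CONDITIONAL; nothing booked; BSD for no curve. [cite: Kato2004Asterisque, Thm. 14.5 (3) (p. 236)]
[cite: CoatesSujatha2005, Thm. 3.4 (§3)] [cite: Washington1997, §7.5, §13.1] -/
theorem missingUpperBoundAt_three_tame_of_hasModPImageEqNonsplitCartanNormalizer_of_realMu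
    (hKatoA : Kato2004.rankZero_padicValNat_sha_add_padicValNat_tamagawa_le_of_additive_potGood_of_irreducible_of_fineSelmerDual_fg)
    (hGZK : rank_eq_analyticRank_of_analyticRank_le_one) (hmod : hasEntireLFunction_rat)
    (hCS : CoatesSujatha2005.thm34_fineSelmerDual_moduleFinite_of_classicalMuVanishes_divisionField)
    (hFW : ferreroWashington1979_classicalMuVanishes) [Fact (3 : ℕ).Prime]
    (hr : W.analyticRank = 0) (hadd : Addv W 3) (hT : SubTprime W 3) (hirr : W.HasIrreducibleModPGaloisRep 3)
    (himg : HasModPImageEqNonsplitCartanNormalizer W 3) {c : absoluteGaloisGroup ℚ}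
    (hc : IsComplexConjugation (Rat.castHom ℝ) c)
    (hμ : ∀ κE : ZpExtension ↥(fixedField (Subgroup.zpowers (absRestrictNormalHom (W.divisionField 3) c))) 3,
      κE.IsCyclotomic → ClassicalMuVanishes κE)
    (hμ' : ∀ τm : absoluteGaloisGroup ℚ, (∀ T : W.geomTorsion (3 : ℕ), τm • T = -T) →
      ∀ κE : ZpExtension ↥(fixedField (Subgroup.zpowers (absRestrictNormalHom (W.divisionField 3) c) ⊔
        Subgroup.zpowers (absRestrictNormalHom (W.divisionField 3) τm))) 3, κE.IsCyclotomic → ClassicalMuVanishes κE) :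
    MissingUpperBoundAt W 3 :=
  missingUpperBoundAt_tame_of_irreducible_of_fineSelmerDual_fg hKatoA hGZK hmod W 3 hr (by decide) hadd hT hirr
    (CartanMuRoadRealDoors.conjA_three_of_hasModPImageEqNonsplitCartanNormalizer_of_realMu W hCS hFW himg hc hμ hμ')

end Upper

end Summit.BirchSwinnertonDyer.BirchSwinnertonDyer.Theorems.CartanMuRoadRealDoorsTprime

end
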